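import Summits.MatrixMultiplication.MatrixMultiplication.Theorems.LittleCwFarEdgeBoundLayers

/-!
# Route `FarEdgeDescent` — the little-CW far-edge bound `LittleCwFarEdgeBound`, PROVED (chain file 3/3)

`∀ q ≥ 2, k ≥ 1, r : R̃(cw_q) ≤ r ⟹ ω(1,1,k) ≤ (k+2)(log r − h(1/(k+2)))/log q` — the first-power laser method for the
LITTLE Coppersmith–Winograd tensor `cw_q` in the far-rectangular weighting (letter rates `1/(k+2), 1/(k+2), k/(k+2)` on the
blocks `(1,1,0), (0,1,1), (1,0,1)`), with the ASYMPTOTIC RANK of `cw_q` as a parameter (BCS 1997 Thm. 15.41 / CW 1990 §6 made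
rectangular) — the dictionary between the `PowerAmortisation` leaf (stmt-MatrixMultiplication-25347) of route `FarEdgeDescent`
and the little-`cw` asymptotic-rank programme (CW90 §11 / CGLV 2022 / Alman–Li 2026).  Lens decl (FarEdgeDescent_v4 §LittleCw)
`LittleCwFarEdgeBound`; here `littleCwFarEdgeBound`, plus the unconditional sweet-spot dictionary
`R̃(cw_{k+1}) ≤ k+2+η ⟹ e(k) ≤ η/log(k+1)` (`excess_le_of_littleCwDeficiency`, `LittleCwSweetSpot`).  The CONDITIONAL rungs
of the deficiency ladder (`η = 0` once ⟹ `FiniteSaturation`; `η_q ≤ C q^{−γ}` ⟹ `PowerAmortisation`; …) are statements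
`H → <route decl>` with `H` unregistered and stay OUT of the landing chain (companion evidence file `LittleCwFarEdgeBound.lean`
@43fcad93 on stmt-…-25347 / -25355).  Layer D = the `ω`-chain `|Δ| a^{ω(1,1,k)} ≤ R̃(⟨|Δ|⟩⊗⟨a,a,a^k⟩) ≤ R̃(cw_q^{⊗N}) ≤ r^N`
on top of chain files 1–2 (`LittleCwFarEdgeBoundData`, `LittleCwFarEdgeBoundLayers`).  Proposed `--supports
stmt-MatrixMultiplication-25347`; no `Theses` decl is used or imported directly.  Written by the decomp-mm lens-2 planner seat
(gen 5 draft @c5d387b1, re-cut gen 6).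
-/

set_option linter.dupNamespace false

noncomputable section

open Finset
open scoped BigOperators

namespace Summit.MatrixMultiplication.MatrixMultiplication.Theorems.LittleCwFarEdgeBound

open Literature.Computability.AlgebraicComplexity

/-! ## Layer D — the bound -/

section LayerD

/-- VERBATIM copy of the lens decl `FarEdgeDescent_v4.LittleCwFarEdgeBound` (support statement of the
`PowerAmortisation` line): the first-power far-rectangular laser bound for the little Coppersmith–Winograd tensor
with its asymptotic rank as a parameter. -/
def LittleCwFarEdgeBound : Prop :=
  ∀ q k : ℕ, 2 ≤ q → 1 ≤ k → ∀ r : ℝ, asymptoticRank (cwTensor ℂ q) ≤ r →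
    omegaRect ℂ 1 1 (k : ℝ) ≤
      ((k : ℝ) + 2) * (Real.log r - Real.binEntropy (1 / ((k : ℝ) + 2))) / Real.log (q : ℝ)

/-- `cw_q ≠ 0` for `q ≥ 1` (the entry `(x₀, y₁, z₁)` is `1`). -/
theorem cwTensor_ne_zero {q : ℕ} (hq : 1 ≤ q) : cwTensor ℂ q ≠ 0 := by
  intro h0
  have h1 := congrFun (congrFun (congrFun h0 0) (Fin.succ ⟨0, by omega⟩)) (Fin.succ ⟨0, by omega⟩)
  rw [cwTensor_zero_succ_succ] at h1
  simp at h1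

open Literature.Barriers.MatrixMultiplication in
/-- **The little-CW far-edge bound, PROVED**: `R̃(cw_q) ≤ r ⟹ ω(1,1,k) ≤ (k+2)(log r − h(1/(k+2)))/log q`
(`q ≥ 2`, `k ≥ 1`).  Chain: `|Δ|·a^{ω(1,1,k)} ≤ R̃(⟨|Δ|⟩ ⊗ ⟨a,a,a^k⟩) ≤ R̃(cw_q^{⊗N}) ≤ R̃(cw_q)^N ≤ r^N ≤ |Δ|·a^{E+δ}`
with `a = q^L`, `N = L(k+2)`, by layers A–C. [cite: BurgisserClausenShokrollahi1997, Thm. 15.41; CoppersmithWinograd1990, §6] -/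
theorem littleCwFarEdgeBound : LittleCwFarEdgeBound := by
  intro q k hq hk r hr
  have hq1n : 1 ≤ q := by omega
  have hr1 : 1 ≤ r := (one_le_asymptoticRank_of_ne_zero (cwTensor_ne_zero (q := q) hq1n)).trans hr
  have hr0 : 0 < r := one_pos.trans_le hr1
  obtain ⟨N₀, hN₀⟩ : ∃ N₀ : ℕ, N₀ = k + 2 := ⟨_, rfl⟩
  have hN₀2 : 2 ≤ N₀ := by omega
  have hN₀r : (N₀ : ℝ) = (k : ℝ) + 2 := by rw [hN₀]; push_cast; ring
  have hk0 : (0 : ℝ) ≤ (k : ℝ) := Nat.cast_nonneg k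
  have hk2 : (0 : ℝ) < (k : ℝ) + 2 := by linarith
  have hq1 : (1 : ℝ) < q := by exact_mod_cast (lt_of_lt_of_le one_lt_two hq)
  have hlogq : 0 < Real.log (q : ℝ) := Real.log_pos hq1
  set Hmin : ℝ := Real.binEntropy (1 / ((k : ℝ) + 2)) with hHmin
  have hE : ((k : ℝ) + 2) * (Real.log r - Hmin) / Real.log (q : ℝ) =
      (Real.log r - Hmin) / ((((1 : ℕ) : ℝ)) / (N₀ : ℝ) * Real.log (q : ℝ)) := by
    rw [hN₀r]; push_cast; field_simp
  rw [hE]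
  refine le_of_forall_pos_lt_add fun δ hδ => ?_
  obtain ⟨L, hL, hC⟩ := lcwThreshold q 1 N₀ hq le_rfl hN₀2 r Hmin (δ / 2) hr0 (half_pos hδ)
  have hL0 : (0 : ℝ) < L := by exact_mod_cast (by omega : 0 < L)
  -- the scaled type `(L, L, kL)`, `N = L N₀`
  have hNL : (k + 2) * (L * 1) = L * N₀ := by rw [hN₀]; ring
  set P : Fin 3 × Fin 3 × Fin 3 → ℝ := fun x =>
    ((if x = (1, 1, 0) then L * 1 else if x = (0, 1, 1) then L * 1
        else if x = (1, 0, 1) then k * (L * 1) else 0 : ℕ) : ℝ) / (((L * N₀ : ℕ) : ℝ)) with hPdef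
  have hPs : ∀ x, P x = ((if x = (1, 1, 0) then L * 1 else if x = (0, 1, 1) then L * 1
        else if x = (1, 0, 1) then k * (L * 1) else 0 : ℕ) : ℝ) / (((L * N₀ : ℕ) : ℝ)) := fun x => rfl
  have hL1 : 1 ≤ L * 1 := by omega
  obtain ⟨Δ, hS, hcnt, hfree, hsize⟩ := lcwDiagonalRaw (L * 1) k (L * N₀) hL1 hk hNL P hPs
  have hent := lcwEntropy (L * 1) k (L * N₀) hL1 hk hNL P hPs
  -- `exp(N · Hmin) ≤ 2^{N (min H − Γ)} ≤ |Δ| · loss`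
  set X : ℝ := min (shannonEntropy (marginalDist₁ P))
      (min (shannonEntropy (marginalDist₂ P)) (shannonEntropy (marginalDist₃ P))) -
      maxEntropyPenalty lcwSupport₃ P with hX
  have hNn : (0 : ℝ) ≤ (((L * N₀ : ℕ) : ℝ)) := Nat.cast_nonneg _
  have hexp : Real.exp ((((L * N₀ : ℕ) : ℝ)) * Hmin) ≤ (2 : ℝ) ^ ((((L * N₀ : ℕ) : ℝ)) * X) := by
    rw [Real.rpow_def_of_pos two_pos, Real.exp_le_exp]
    calc (((L * N₀ : ℕ) : ℝ)) * Hmin ≤ (((L * N₀ : ℕ) : ℝ)) * (Real.log 2 * X) :=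
          mul_le_mul_of_nonneg_left hent hNn
      _ = Real.log 2 * ((((L * N₀ : ℕ) : ℝ)) * X) := by ring
  have hnum := hC Δ.card (hexp.trans hsize)
  -- the tensor layer and the `ω`-chain
  have hres := lcwRectRestriction q (L * 1) (L * 1) (k * (L * 1)) (L * N₀) Δ hS hcnt hfree
  have hdeg : PolyDegeneratesTo (kroneckerPow (cwTensor ℂ q) (L * N₀))
      (kroneckerTensor (unitTensor ℂ Δ.card)
        (matMulTensor ℂ (q ^ (L * 1)) (q ^ (L * 1)) (q ^ (k * (L * 1))))) := hres.polyDegeneratesTo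
  have hV : 1 ≤ Δ.card := by
    by_contra h0
    have h0' : Δ.card = 0 := by omega
    rw [h0', Nat.cast_zero, zero_mul, zero_mul, zero_mul] at hsize
    exact absurd (hexp.trans hsize) (not_le.2 (Real.exp_pos _))
  have hNpos : 0 < L * N₀ := Nat.mul_pos (by omega) (by omega)
  have ha : 2 ≤ q ^ (L * 1) := le_trans hq (Nat.le_self_pow (by omega) q)
  have haB : (q ^ (L * 1)) ^ k ≤ q ^ (k * (L * 1)) := by rw [← pow_mul, mul_comm]
  have ha1 : (1 : ℝ) < ((q ^ (L * 1) : ℕ) : ℝ) := by exact_mod_cast (by omega : 1 < q ^ (L * 1))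
  have hV0 : (0 : ℝ) < (Δ.card : ℝ) := by exact_mod_cast (by omega : 0 < Δ.card)
  have haB' : (((q ^ (L * 1) : ℕ) : ℝ)) ^ (k : ℝ) ≤ (((q ^ (k * (L * 1)) : ℕ) : ℝ)) := by
    rw [Real.rpow_natCast]
    exact_mod_cast haB
  have h1 := mul_rpow_omegaRect_le_asymptoticRank ℂ hk0 hV ha haB'
  have h2 := asymptoticRank_le_of_polyDegeneratesTo hdeg
  have h3' : asymptoticRank (kroneckerPow (cwTensor ℂ q) (L * N₀)) ≤ r ^ (L * N₀) :=
    (asymptoticRank_kroneckerPow_le _ hNpos).trans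
      (pow_le_pow_left₀ (asymptoticRank_nonneg _) hr _)
  set E : ℝ := (Real.log r - Hmin) / ((((1 : ℕ) : ℝ)) / (N₀ : ℝ) * Real.log (q : ℝ)) with hEdef
  have hchain : (Δ.card : ℝ) * (((q ^ (L * 1) : ℕ) : ℝ)) ^ omegaRect ℂ 1 1 (k : ℝ) ≤
      (Δ.card : ℝ) * (((q ^ (L * 1) : ℕ) : ℝ)) ^ (E + δ / 2) :=
    h1.trans (h2.trans (h3'.trans hnum))
  have h4 : (((q ^ (L * 1) : ℕ) : ℝ)) ^ omegaRect ℂ 1 1 (k : ℝ) ≤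
      (((q ^ (L * 1) : ℕ) : ℝ)) ^ (E + δ / 2) :=
    le_of_mul_le_mul_left hchain hV0
  have h5 : omegaRect ℂ 1 1 (k : ℝ) ≤ E + δ / 2 := (Real.rpow_le_rpow_left_iff ha1).1 h4
  linarith

/-- Name used by the lens draft `FarEdgeDescent_v4` (`hB : LittleCwFarEdgeBound` there is now a theorem). -/
theorem littleCwFarEdgeBound_holds : LittleCwFarEdgeBound := littleCwFarEdgeBound

end LayerD

/-! ## Corollary — the sweet-spot dictionary `deficiency of cw_{k+1} ↦ excess e(k)`, unconditional

At the sweet spot `q = k+1`, `r = k+2` the bound is exactly `k+1` (`(K+2)(log(K+2) − h(1/(K+2)))/log(K+1) = K+1`,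
`binEntropy_far`); so `R̃(cw_{k+1}) ≤ k+2+η` gives `e(k) ≤ η/log(k+1)`.  With the border-rank input `η ≤ 1`
(`R̃ ≤ bR(cw_q) = q+2`) this is `e(k) ≤ 1/log(k+1)`; with the tree's Alman–Li theorem
`AlmanLi2026.asymptoticRank_cwTensor_lt` (`η_q < 1`, module `AlmanLi2026BelowBorderRank`, olean not built on the farm at
the time of writing, hence not imported) it is strict; `PowerAmortisation` needs `η_q ≤ C q^{−γ}·log q`. -/

section Dictionary


/-- The far-edge entropy identity `(K+2)·h(1/(K+2)) = (K+2) log(K+2) − (K+1) log(K+1)`. -/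
theorem binEntropy_far (K : ℝ) (hK : 0 ≤ K) :
    (K + 2) * Real.binEntropy (1 / (K + 2)) =
      (K + 2) * Real.log (K + 2) - (K + 1) * Real.log (K + 1) := by
  have h1 : (0 : ℝ) < K + 1 := by linarith
  have h2 : (0 : ℝ) < K + 2 := by linarith
  have e2 : 1 - 1 / (K + 2) = (K + 1) / (K + 2) := by
    rw [eq_div_iff h2.ne', sub_mul, one_div, inv_mul_cancel₀ h2.ne']
    ring
  have ebin : Real.binEntropy (1 / (K + 2)) =
      (1 / (K + 2)) * Real.log (K + 2) +
        ((K + 1) / (K + 2)) * (Real.log (K + 2) - Real.log (K + 1)) := by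
    rw [Real.binEntropy, e2, one_div, inv_inv, inv_div, Real.log_div h2.ne' h1.ne', ← one_div]
  rw [ebin]
  field_simp
  ring

/-- **The dictionary lemma (unconditional).** If `R̃(cw_{k+1}) ≤ k + 2 + η` (`η ≥ 0`, `k ≥ 1`), then
`e(k) = ω(1,k,1) − (k+1) ≤ η / log(k+1)`. -/
theorem excess_le_of_littleCwDeficiency {k : ℕ} (hk : 1 ≤ k) {η : ℝ}
    (hη : 0 ≤ η) (hr : asymptoticRank (cwTensor ℂ (k + 1)) ≤ (k : ℝ) + 2 + η) :
    omegaRect ℂ 1 k 1 - (k + 1) ≤ η / Real.log ((k : ℝ) + 1) := by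
  have hq : 2 ≤ k + 1 := by omega
  have hb := littleCwFarEdgeBound (k + 1) k hq hk ((k : ℝ) + 2 + η) hr
  rw [← omegaRect_one_mid_one ℂ (k : ℝ)] at hb
  push_cast at hb
  have hk' : (1 : ℝ) ≤ (k : ℝ) := by exact_mod_cast hk
  have h1 : (0 : ℝ) < (k : ℝ) + 1 := by linarith
  have h2 : (0 : ℝ) < (k : ℝ) + 2 := by linarith
  have hlog1 : 0 < Real.log ((k : ℝ) + 1) := Real.log_pos (by linarith)
  have hid := binEntropy_far (k : ℝ) (by linarith)
  have hlogle : Real.log ((k : ℝ) + 2 + η) ≤ Real.log ((k : ℝ) + 2) + η / ((k : ℝ) + 2) := by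
    have hpos : 0 < ((k : ℝ) + 2 + η) / ((k : ℝ) + 2) := div_pos (by linarith) h2
    have hl := Real.log_le_sub_one_of_pos hpos
    rw [Real.log_div (by linarith) h2.ne', div_sub_one h2.ne'] at hl
    have e : ((k : ℝ) + 2 + η - ((k : ℝ) + 2)) / ((k : ℝ) + 2) = η / ((k : ℝ) + 2) := by ring
    linarith
  have key : ((k : ℝ) + 2) * (Real.log ((k : ℝ) + 2 + η) - Real.binEntropy (1 / ((k : ℝ) + 2))) ≤
      ((k : ℝ) + 1) * Real.log ((k : ℝ) + 1) + η := by
    have e1 : ((k : ℝ) + 2) * (Real.log ((k : ℝ) + 2 + η) - Real.binEntropy (1 / ((k : ℝ) + 2))) =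
        ((k : ℝ) + 2) * Real.log ((k : ℝ) + 2 + η) -
          ((k : ℝ) + 2) * Real.binEntropy (1 / ((k : ℝ) + 2)) := by
      ring
    rw [e1, hid]
    have h3 := mul_le_mul_of_nonneg_left hlogle h2.le
    have e2 : ((k : ℝ) + 2) * (Real.log ((k : ℝ) + 2) + η / ((k : ℝ) + 2)) =
        ((k : ℝ) + 2) * Real.log ((k : ℝ) + 2) + η := by
      field_simp
    linarith
  have hb2 : omegaRect ℂ 1 (k : ℝ) 1 ≤
      (((k : ℝ) + 1) * Real.log ((k : ℝ) + 1) + η) / Real.log ((k : ℝ) + 1) :=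
    hb.trans (div_le_div_of_nonneg_right key hlog1.le)
  rw [add_div, mul_div_cancel_right₀ _ hlog1.ne'] at hb2
  linarith

/-- **The sweet-spot dictionary as a named statement** (lens decl `LittleCwSweetSpot`): for every `k ≥ 1` and
`η ≥ 0`, `R̃(cw_{k+1}) ≤ k + 2 + η ⟹ e(k) = ω(1,k,1) − (k+1) ≤ η / log(k+1)`.  With `η = 1` (border rank) this is
the Coppersmith-type bound `e(k) ≤ 1/log(k+1)`; the route's leaves read off it as `η = 0 ⟹ e(k) = 0`
(`FiniteSaturation`), `η_q ≤ C q^{−γ} ⟹ PowerAmortisation`, `η_q → 0 ⟹ SubLogRate` (companion evidence file). -/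
def LittleCwSweetSpot : Prop :=
  ∀ k : ℕ, 1 ≤ k → ∀ η : ℝ, 0 ≤ η →
    asymptoticRank (cwTensor ℂ (k + 1)) ≤ (k : ℝ) + 2 + η →
      omegaRect ℂ 1 (k : ℝ) 1 - ((k : ℝ) + 1) ≤ η / Real.log ((k : ℝ) + 1)

/-- `LittleCwSweetSpot` holds (from `excess_le_of_littleCwDeficiency`). -/
theorem littleCwSweetSpot : LittleCwSweetSpot :=
  fun _k hk _η hη hr => excess_le_of_littleCwDeficiency hk hη hr



end Dictionary

end Summit.MatrixMultiplication.MatrixMultiplication.Theorems.LittleCwFarEdgeBound
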